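import Literature.NumberTheory.Irrationality.RivoalZudilin2020.DenominatorsPadic
import Literature.NumberTheory.Irrationality.RivoalZudilin2020.DenominatorsTransfer
import Literature.NumberTheory.Transcendental.OddZetaPartialFractions
import HarnessLib

/-!
# Rivoal–Zudilin 2020, Proposition 1 (ii) PROVED: `Φ_n^{−3} d_n^{A+2}` is a common denominator

Topic `Literature/NumberTheory/Irrationality/RivoalZudilin2020`; proofs-only companion of
`TwoIrrationalOddZetaValues.lean`, discharging its named fact `proposition1_ii` (`proposition1_ii_holds`).
Source: T. Rivoal, W. Zudilin, *A note on odd zeta values*, Sém. Lothar. Combin. **81** (2020) B81b =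
arXiv:1803.03160 [RivoalZudilin2020], Proposition 1 (ii) and its proof (§3, arXiv pp. 5–6).

Assembly of the printed proof:
* prime by prime, from `d_n^a 𝒟_a(R(t)(t+m)^A)(−m) ∈ ℤ` (`DenominatorsBricks.lean`) and
  `ord_p 𝒟_a(R(t)(t+m)^A)(−m) ≥ 3ρ₀(n/p) − a` for `p² > 4n` (`DenominatorsPadic.lean`), with `ord_p d_n = 1` for
  `√n < p ≤ n` and `ord_p Φ_n = ρ₀(n/p)` for the primes of `Φ_n` (`padicValNat_Phi`; the typed real step function
  `rho0` agrees with the integer one, `rho0_div_eq_rho0Nat`): `Φ_n^{−3} d_n^{A−j} p_{j,m} ∈ ℤ`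
  (`isZ_pCoeff`, through `pCoeff_eq_ratCast` of `DenominatorsTransfer.lean`);
* "From the expressions of `q_{j,n}` in (10) and (11), we then deduce that `Φ_n^{−3}d_n^{A+2}q_{0,n} ∈ ℤ` and
  `Φ_n^{−3}d_n^{A+2}q_{j,n} ∈ ℤ` for any odd `j ≥ 5`" (`isZ_qCoeff`, `isZ_qZero`: `d_n^{j+2}/k^{j+2} ∈ ℤ` for
  `k ≤ m ≤ n`);
* `q̂_{0,n}`: "This argument does not work directly for `q̂_{0,n}` with the expression in (8) … Since `R″(k) = 0`
  for `k = −½, −3/2, …, −n+½`, in particular `R″(k−½) = 0` for `k = −ω, …, −1, 0` … [`ω = ⌊(n−1)/2⌋`] …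
  Comparing (12) with (9) … This expression is more suitable than (8) and an analysis similar to [zud2]
  shows that `Φ_n^{−3}d_n^{A+2}q̂_{0,n} ∈ ℤ`": we add the vanishing sum `Σ_{u=0}^{ω} R″(−u−½) = 0`
  (`iteratedDeriv_two_rfun_half_eq_zero`, a triple zero of `R`), expanded by the partial fractions
  (`iteratedDeriv_two_rfun_of_ne`), to the expression (8); in the combination, for each `(j,m)` the half-integer
  denominators `(m−u−½)^{j+2}` that survive have `|2m−2u−1| ≤ n`, so `d_n^{j+2}` clears them (`isZ_qZeroHat`).
  (For `n = 0`, `q̂_{0,0} = 0`.)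

HONEST FRAMING (cells pub-zeta5 / zeta5-irr): this is the denominator half of the paper ("two of
`ζ(5),…,ζ(69)` are irrational" still rests on the saddle-point Proposition 3, a named fact); nothing here
concerns `ζ(5)` alone.
-/

noncomputable section

open Finset Filter Topology
open Literature.Analysis.Calculus
open Literature.NumberTheory.Transcendental
open Literature.NumberTheory.Transcendental.OddZeta (IsZ dn isZ_dn_div)
open scoped Nat

namespace Literature.NumberTheory.Irrationality.RivoalZudilin2020

/-! ### The arithmetic of `Φ_n` and `d_n` -/

/-- The typed step function `ρ₀` at `n/p` is the integer-arithmetic `rho0Nat n p` (`{n/p} = (n mod p)/p`).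
[cite: RivoalZudilin2020, §3 (proof of Proposition 1 (ii), ρ₀)] -/
theorem rho0_div_eq_rho0Nat (n : ℕ) {p : ℕ} (hp : 0 < p) : rho0 ((n : ℝ) / p) = rho0Nat n p := by
  have hfr : Int.fract ((n : ℝ) / p) = ((n % p : ℕ) : ℝ) / p := Int.fract_div_natCast_eq_div_natCast_mod
  have hp' : (0 : ℝ) < p := by exact_mod_cast hp
  have key : ∀ u v : ℕ, 0 < v →
      (((n % p : ℕ) : ℝ) / p < (u : ℝ) / v ↔ v * (n % p) < u * p) := by
    intro u v hv
    rw [div_lt_div_iff₀ hp' (by exact_mod_cast hv)]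
    constructor
    · intro h
      have h' : ((v : ℝ) * ((n % p : ℕ) : ℝ)) < (u : ℝ) * (p : ℝ) := by linarith
      exact_mod_cast h'
    · intro h
      have : ((v : ℝ) * ((n % p : ℕ) : ℝ)) < (u : ℝ) * (p : ℝ) := by exact_mod_cast h
      linarith
  have k13 := key 1 3 (by norm_num)
  have k12 := key 1 2 (by norm_num)
  have k23 := key 2 3 (by norm_num)
  have k56 := key 5 6 (by norm_num)
  simp only [Nat.cast_one, one_mul, Nat.cast_ofNat] at k13 k12 k23 k56
  unfold rho0 rho0Nat
  rw [hfr]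
  by_cases c1 : 3 * (n % p) < p
  · rw [if_pos (by rw [one_div]; rw [one_div] at k13; exact (k13.2 (by omega))), if_pos c1]
  · rw [if_neg (fun h => c1 (by rw [← k13]; simpa [one_div] using h)), if_neg c1]
    by_cases c2 : 2 * (n % p) < p
    · rw [if_pos (by rw [one_div]; rw [one_div] at k12; exact k12.2 (by omega)), if_pos c2]
    · rw [if_neg (fun h => c2 (by rw [← k12]; simpa [one_div] using h)), if_neg c2]
      by_cases c3 : 3 * (n % p) < 2 * p
      · rw [if_pos (k23.2 c3), if_pos c3]
      · rw [if_neg (fun h => c3 (k23.1 h)), if_neg c3]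
        by_cases c4 : 6 * (n % p) < 5 * p
        · rw [if_pos (k56.2 c4), if_pos c4]
        · rw [if_neg (fun h => c4 (k56.1 h)), if_neg c4]

/-- `ord_p` of a product of prime powers over a set of primes. [folklore] -/
private theorem padicValNat_prod_prime_pow' {p : ℕ} [hp : Fact p.Prime] (S : Finset ℕ)
    (hS : ∀ q ∈ S, q.Prime) (e : ℕ → ℕ) :
    padicValNat p (∏ q ∈ S, q ^ e q) = if p ∈ S then e p else 0 := by
  classical
  induction S using Finset.induction_on with
  | empty => simp
  | insert a S ha ih =>
    have haP : a.Prime := hS a (mem_insert_self a S)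
    have hS' : ∀ q ∈ S, q.Prime := fun q hq => hS q (mem_insert_of_mem hq)
    rw [prod_insert ha, padicValNat.mul (pow_ne_zero _ haP.ne_zero)
      (prod_ne_zero_iff.2 fun q hq => pow_ne_zero _ (hS' q hq).ne_zero), ih hS',
      padicValNat.pow]
    by_cases hpa : p = a
    · subst hpa
      rw [padicValNat_self, if_pos (mem_insert_self p S), if_neg ha]; ring
    · haveI : Fact a.Prime := ⟨haP⟩
      rw [padicValNat_primes hpa, mul_zero, zero_add]
      by_cases hpS : p ∈ S
      · rw [if_pos hpS, if_pos (mem_insert_of_mem hpS)]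
      · rw [if_neg hpS, if_neg (by simp [hpa, hpS])]

/-- `ord_p Φ_n = ρ₀(n/p)` for primes `p ≤ n` with `p² > 4n`, and `0` for the other primes.
[cite: RivoalZudilin2020, §3 (Phi_n)] -/
theorem padicValNat_Phi (n : ℕ) {p : ℕ} [hp : Fact p.Prime] :
    padicValNat p (Phi n) = if p ≤ n ∧ 4 * n < p * p then rho0Nat n p else 0 := by
  unfold Phi
  rw [padicValNat_prod_prime_pow' _ (fun q hq => (mem_filter.1 hq).2.1)]
  have hmem : p ∈ (Ioc 0 n).filter (fun p => p.Prime ∧ 4 * n < p * p) ↔ (p ≤ n ∧ 4 * n < p * p) := by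
    simp only [mem_filter, mem_Ioc]
    exact ⟨fun ⟨⟨_, h1⟩, _, h2⟩ => ⟨h1, h2⟩, fun ⟨h1, h2⟩ => ⟨⟨hp.out.pos, h1⟩, hp.out, h2⟩⟩
  by_cases h : p ≤ n ∧ 4 * n < p * p
  · rw [if_pos (hmem.2 h), if_pos h, rho0_div_eq_rho0Nat n hp.out.pos]
  · rw [if_neg (fun h' => h (hmem.1 h')), if_neg h]

/-- `ord_p d_n = 1` for a prime `p ≤ n < p²`. [folklore] -/
private theorem padicValNat_lcmUpto_eq_one {p n : ℕ} [hp : Fact p.Prime] (h1 : p ≤ n) (h2 : n < p ^ 2) :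
    padicValNat p (Nat.lcmUpto n) = 1 := by
  rw [← Nat.factorization_def _ hp.out, Nat.factorization_lcmUpto n hp.out]
  exact (Nat.log_eq_iff (Or.inl one_ne_zero)).2 ⟨by simpa using h1, by simpa using h2⟩

/-! ### `Φ_n^{-3} d_n^{a} 𝒟_a (R(t)(t+m)^A)(-m) ∈ ℤ` -/

/-- **`Φ_n^{−3} d_n^{a} 𝒟_a(R(t)(t+m)^A)(−m) ∈ ℤ`** for all `a` and `m ≤ n` (over `ℚ`): the source's
"`Φ_n^{−3} d_n^{A−j} p_{j,m} ∈ ℤ`" prime by prime — for the primes of `Φ_n` by the `p`-adic bound, for the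
others by the `d_n`-integrality. [cite: RivoalZudilin2020, §3 (proof of Proposition 1 (ii), "Φ_n^{-3} d_n^{A-j} p_{j,m} ∈ ℤ")] -/
theorem exists_int_div_Phi_pow_divDeriv_RregBrick (A n : ℕ) {m : ℕ} (hm : m ≤ n) (a : ℕ) :
    ∃ z : ℤ, ((Nat.lcmUpto n : ℕ) : ℚ) ^ a / ((Phi n : ℕ) : ℚ) ^ 3 *
      divDeriv a (RregBrick A n m) (-(m : ℚ)) = z := by
  obtain ⟨z₀, hz₀⟩ := exists_int_lcm_pow_mul_divDeriv_RregBrick A n hm a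
  have hΦ : ((Phi n : ℕ) : ℚ) ≠ 0 := by exact_mod_cast (Phi_pos n).ne'
  have hrew : ((Nat.lcmUpto n : ℕ) : ℚ) ^ a / ((Phi n : ℕ) : ℚ) ^ 3 * divDeriv a (RregBrick A n m) (-(m : ℚ))
      = (z₀ : ℚ) * ((((Phi n : ℕ) : ℚ)) ^ 3)⁻¹ := by
    rw [← hz₀]; field_simp
  rw [hrew]
  refine Rat.exists_int_of_padicOrdGe fun p hpr => ?_
  haveI : Fact p.Prime := ⟨hpr⟩
  have hinv : PadicOrdGe p (-(3 * (padicValNat p (Phi n) : ℤ))) ((((Phi n : ℕ) : ℚ) ^ 3)⁻¹) := by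
    refine PadicOrdGe.of_eq (le_of_eq ?_)
    rw [padicValRat.inv, padicValRat.pow, padicValRat.of_nat]
    push_cast; ring
  by_cases hΦp : p ≤ n ∧ 4 * n < p * p
  · -- a prime of `Φ_n`: use the `p`-adic bound on the divided derivative
    have hp2 : 4 * n < p ^ 2 := by rw [sq]; exact hΦp.2
    have hn2 : n < p ^ 2 := by omega
    have hP := padicOrdGe_divDeriv_RregBrick A n hm hp2 a (p := p)
    have hd : PadicOrdGe p (a : ℤ) (((Nat.lcmUpto n : ℕ) : ℚ) ^ a) := by
      refine PadicOrdGe.of_eq (le_of_eq ?_)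
      rw [padicValRat.pow, padicValRat.of_nat, padicValNat_lcmUpto_eq_one hΦp.1 hn2]
      push_cast; ring
    have hz : PadicOrdGe p (3 * (rho0Nat n p : ℤ)) (z₀ : ℚ) := by
      rw [← hz₀]
      exact (hd.mul hP).mono (by omega)
    rw [padicValNat_Phi n, if_pos hΦp] at hinv
    exact (hz.mul hinv).mono (by omega)
  · rw [padicValNat_Phi n, if_neg hΦp] at hinv
    exact ((PadicOrdGe.of_int z₀).mul hinv).mono (by simp)

/-- **`Φ_n^{−3} d_n^{A−j} p_{j,m} ∈ ℤ`** for the typed real coefficients (`A ≥ 15`, `m ≤ n`, `1 ≤ j ≤ A`).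
[cite: RivoalZudilin2020, §3 (proof of Proposition 1 (ii), "Φ_n^{-3} d_n^{A-j} p_{j,m} ∈ ℤ")] -/
theorem isZ_pCoeff (A n : ℕ) (hA : 15 ≤ A) {m : ℕ} (hm : m ≤ n) {j : ℕ} (hj1 : 1 ≤ j) (hjA : j ≤ A) :
    IsZ ((Nat.lcmUpto n : ℝ) ^ (A - j) / (Phi n : ℝ) ^ 3 * pCoeff A n j m) := by
  obtain ⟨z, hz⟩ := exists_int_div_Phi_pow_divDeriv_RregBrick A n hm (A - j)
  refine ⟨z, ?_⟩
  rw [pCoeff_eq_ratCast A n hA hm hj1 hjA]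
  have := congrArg (fun q : ℚ => (q : ℝ)) hz
  simpa using this

/-! ### `q_{j,n}` and `q_{0,n}` -/

/-- **`Φ_n^{−3} d_n^{A+2} q_{j,n} ∈ ℤ`** for `j ∈ oddRange A` (indeed for `3 ≤ j ≤ A + 2`).
[cite: RivoalZudilin2020, Proposition 1 (ii) (q_{j,n})] -/
theorem isZ_qCoeff (A n : ℕ) (hA : 15 ≤ A) {j : ℕ} (hj3 : 3 ≤ j) (hjA : j ≤ A + 2) :
    IsZ ((Nat.lcmUpto n : ℝ) ^ (A + 2) / (Phi n : ℝ) ^ 3 * qCoeff A n j) := by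
  rw [qCoeff, mul_sum]
  refine IsZ.sum _ fun m hm => ?_
  have hm' : m ≤ n := by have := mem_range.1 hm; omega
  have hp := isZ_pCoeff A n hA hm' (j := j - 2) (by omega) (by omega)
  have hsplit : (Nat.lcmUpto n : ℝ) ^ (A + 2) = (Nat.lcmUpto n : ℝ) ^ j * (Nat.lcmUpto n : ℝ) ^ (A - (j - 2)) := by
    rw [← pow_add]; congr 1; omega
  have hjj : IsZ (((j : ℝ) - 2) * ((j : ℝ) - 1)) := ⟨((j : ℤ) - 2) * ((j : ℤ) - 1), by push_cast; ring⟩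
  have hd : IsZ ((Nat.lcmUpto n : ℝ) ^ j) := ⟨(Nat.lcmUpto n : ℤ) ^ j, by push_cast; ring⟩
  have := (hjj.mul hd).mul hp
  rw [hsplit]
  convert this using 1
  ring

/-- `d_n^{s}/k^{s} ∈ ℤ` for `1 ≤ k ≤ n`. [folklore] -/
private theorem isZ_lcm_pow_div_pow {n k : ℕ} (hk1 : 1 ≤ k) (hkn : k ≤ n) (s : ℕ) :
    IsZ ((Nat.lcmUpto n : ℝ) ^ s / (k : ℝ) ^ s) := by
  have h := isZ_dn_div (n := n) (δ := (k : ℤ)) (by omega) (by simpa using hkn)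
  rw [dn] at h
  have := h.pow s
  simpa [div_pow] using this

/-- **`Φ_n^{−3} d_n^{A+2} q_{0,n} ∈ ℤ`**. [cite: RivoalZudilin2020, Proposition 1 (ii) (q_{0,n})] -/
theorem isZ_qZero (A n : ℕ) (hA : 15 ≤ A) :
    IsZ ((Nat.lcmUpto n : ℝ) ^ (A + 2) / (Phi n : ℝ) ^ 3 * qZero A n) := by
  rw [qZero, mul_neg, mul_sum]
  refine IsZ.neg (IsZ.sum _ fun j hj => ?_)
  have hj' := mem_Icc.1 hj
  rw [mul_sum]
  refine IsZ.sum _ fun m hm => ?_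
  have hm' : m ≤ n := by have := mem_range.1 hm; omega
  rw [mul_sum]
  refine IsZ.sum _ fun k hk => ?_
  have hk' := mem_Icc.1 hk
  have hp := isZ_pCoeff A n hA hm' hj'.1 hj'.2
  have hd := isZ_lcm_pow_div_pow hk'.1 (hk'.2.trans hm') (j + 2)
  have hjj : IsZ ((j : ℝ) * ((j : ℝ) + 1)) := ⟨(j : ℤ) * ((j : ℤ) + 1), by push_cast; ring⟩
  have hsplit : (Nat.lcmUpto n : ℝ) ^ (A + 2) = (Nat.lcmUpto n : ℝ) ^ (A - j) * (Nat.lcmUpto n : ℝ) ^ (j + 2) := by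
    rw [← pow_add]; congr 1; omega
  have hk0 : (k : ℝ) ≠ 0 := by exact_mod_cast (show k ≠ 0 by omega)
  have hΦ : (Phi n : ℝ) ≠ 0 := by exact_mod_cast (Phi_pos n).ne'
  have := (hjj.mul hp).mul hd
  rw [hsplit]
  convert this using 1
  field_simp

/-! ### `R″` at non-poles and its triple zeros at the half-integers -/

/-- Smoothness of `(y+i)^{-s}` at `x` with `x + i ≠ 0`. [folklore] -/
private theorem contDiffAt_inv_pow_of_ne (i s : ℕ) {x : ℝ} (hx : x + i ≠ 0) {N : WithTop ℕ∞} :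
    ContDiffAt ℝ N (fun y : ℝ => ((y + i) ^ s)⁻¹) x :=
  ((contDiffAt_id.add contDiffAt_const).pow s).inv (by simpa using pow_ne_zero s hx)

/-- `d²/dy² (y+i)^{-s} = s(s+1)(y+i)^{-s-2}` (Mathlib's junk conventions make this an identity at every `x`). [folklore] -/
private theorem iteratedDeriv_two_inv_pow' (i s : ℕ) (x : ℝ) :
    iteratedDeriv 2 (fun y : ℝ => ((y + i) ^ s)⁻¹) x = (s : ℝ) * (s + 1) * ((x + i) ^ (s + 2))⁻¹ := by
  have hfun : (fun y : ℝ => ((y + i) ^ s)⁻¹) = fun y => (fun z : ℝ => z ^ (-(s : ℤ))) (y + i) := by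
    funext y
    simp only [zpow_neg, zpow_natCast]
  rw [hfun, iteratedDeriv_comp_add_const 2 (fun z : ℝ => z ^ (-(s : ℤ))) (i : ℝ)]
  simp only
  rw [iteratedDeriv_eq_iterate, iter_deriv_zpow]
  rw [show (-(s : ℤ) - (2 : ℕ)) = -((s + 2 : ℕ) : ℤ) by push_cast; ring, zpow_neg, zpow_natCast]
  simp [Finset.prod_range_succ]
  ring

/-- **`R″(x)` termwise at every non-pole `x`**: `R″(x) = Σ_{m ≤ n} Σ_{j=1}^{A} p_{j,m} · j(j+1) · (x+m)^{−(j+2)}`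
(the display "`d²/dk² (k+m)^{−j} = j(j+1)/(k+m)^{j+2}`", used in (12) at the points `k − ½`, `k ≤ 0`).
[cite: RivoalZudilin2020, §3 proof of Proposition 1 (ii), display (12)] -/
theorem iteratedDeriv_two_rfun_of_ne (A n : ℕ) (hA : 15 ≤ A) {x : ℝ} (hx : ∀ i ∈ range (n + 1), x + i ≠ 0) :
    iteratedDeriv 2 (rfun A n) x = ∑ m ∈ range (n + 1), ∑ j ∈ Icc 1 A,
      pCoeff A n j m * ((j : ℝ) * (j + 1)) * ((x + m) ^ (j + 2))⁻¹ := by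
  have hev : ∀ᶠ y in 𝓝 x, ∀ i ∈ range (n + 1), y + (i : ℝ) ≠ 0 :=
    (eventually_all_finset _).2 fun i hi =>
      ((continuous_add_const (i : ℝ)).continuousAt).eventually_ne (hx i hi)
  have heq : rfun A n =ᶠ[𝓝 x]
      fun y => ∑ m ∈ range (n + 1), ∑ j ∈ Icc 1 A, pCoeff A n j m * ((y + m) ^ j)⁻¹ := by
    filter_upwards [hev] with y hy
    exact rfun_eq_sum_pCoeff A n hA hy
  rw [heq.iteratedDeriv_eq]
  rw [iteratedDeriv_fun_sum fun m hm =>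
    ContDiffAt.sum fun j _ => contDiffAt_const.mul (contDiffAt_inv_pow_of_ne m j (hx m hm))]
  refine sum_congr rfl fun m hm => ?_
  rw [iteratedDeriv_fun_sum fun j _ => contDiffAt_const.mul (contDiffAt_inv_pow_of_ne m j (hx m hm))]
  refine sum_congr rfl fun j _ => ?_
  rw [iteratedDeriv_const_mul _ (contDiffAt_inv_pow_of_ne m j (hx m hm)),
    iteratedDeriv_two_inv_pow' m j x]
  ring

/-- A half-integer `−u − ½` is not a pole. [folklore] -/
private theorem half_add_nat_ne_zero (u i : ℕ) : (-(u : ℝ) - 1 / 2) + i ≠ 0 := by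
  intro h
  have h2 : ((2 * i : ℕ) : ℝ) = ((2 * u + 1 : ℕ) : ℝ) := by push_cast; linarith
  have := (Nat.cast_inj (R := ℝ)).1 h2
  omega

/-- **The triple zeros**: "`R″(k) = 0` for `k = −½, −3/2, …, −n + ½`": for `n + u < 3n` (e.g. `u ≤ ω`),
`R″(−u−½) = 0`, from the factor `(t−n+½)_{3n}^3 ∋ (t + u + ½)^3`.
[cite: RivoalZudilin2020, §3 proof of Proposition 1 (ii) ("R″(k) = 0 for k = −1/2, …, −n+1/2")] -/
theorem iteratedDeriv_two_rfun_half_eq_zero (A n : ℕ) {u : ℕ} (hu : n + u < 3 * n) :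
    iteratedDeriv 2 (rfun A n) (-(u : ℝ) - 1 / 2) = 0 := by
  set x : ℝ := -(u : ℝ) - 1 / 2 with hxdef
  -- the cofactor `g`
  set g : ℝ → ℝ := fun y =>
    (n ! : ℝ) ^ (A - 15) * 2 ^ (18 * n) * (2 * y + n) *
      ((∏ i ∈ range n, (y - n + i)) ^ 3 * (∏ i ∈ range n, (y + n + 1 + i)) ^ 3 *
        (∏ i ∈ (range (3 * n)).erase (n + u), (y - n + 1 / 2 + i)) ^ 3) /
    ∏ k ∈ range (n + 1), (y + k) ^ A with hg
  have hmem : n + u ∈ range (3 * n) := mem_range.2 hu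
  have hfac : ∀ y : ℝ, rfun A n y = (y - x) ^ 3 * g y := by
    intro y
    rw [rfun, hg]
    simp only
    rw [← mul_prod_erase (range (3 * n)) (fun i : ℕ => y - n + 1 / 2 + (i : ℝ)) hmem]
    have : (y - n + 1 / 2 + ((n + u : ℕ) : ℝ)) = y - x := by rw [hxdef]; push_cast; ring
    rw [this]
    ring
  have hfun : rfun A n = fun y => (y - x) ^ 3 * g y := funext hfac
  -- `g` is smooth at `x` (not a pole)
  have hden : ∏ k ∈ range (n + 1), (x + (k : ℝ)) ^ A ≠ 0 :=
    prod_ne_zero_iff.2 fun k _ => pow_ne_zero _ (by rw [hxdef]; exact half_add_nat_ne_zero u k)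
  have hgs : ContDiffAt ℝ 2 g x := by
    rw [hg]
    exact ContDiffAt.div (by fun_prop) (by fun_prop) hden
  rw [hfun, iteratedDeriv_eq_factorial_mul_divDeriv, divDeriv_sub_pow_mul hgs 3, if_pos (by norm_num),
    mul_zero]

/-! ### `q̂_{0,n}` -/

/-- The half-integer denominators cleared by `d_n`: for an odd integer `o = 2m − 2u − 1` with `|o| ≤ n`,
`d_n^{s} · (m − u − ½)^{−s} = (2 d_n / o)^{s} ∈ ℤ`.
[cite: RivoalZudilin2020, §3 (proof of Proposition 1 (ii), "an analysis similar to [zud2]")] -/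
theorem isZ_lcm_pow_mul_inv_half_pow {n m u : ℕ} (ho : ((2 * (m : ℤ) - 2 * u - 1).natAbs ≤ n)) (s : ℕ) :
    IsZ ((Nat.lcmUpto n : ℝ) ^ s * ((-(u : ℝ) - 1 / 2 + m) ^ s)⁻¹) := by
  have ho0 : (2 * (m : ℤ) - 2 * u - 1) ≠ 0 := by omega
  have hcast : (-(u : ℝ) - 1 / 2 + m) = ((2 * (m : ℤ) - 2 * u - 1 : ℤ) : ℝ) / 2 := by push_cast; ring
  have hne : (((2 * (m : ℤ) - 2 * u - 1 : ℤ)) : ℝ) ≠ 0 := by exact_mod_cast ho0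
  have h := ((IsZ.int 2).mul (isZ_dn_div (n := n) ho0 ho)).pow s
  rw [dn] at h
  convert h using 1
  rw [hcast, ← inv_pow, ← mul_pow]
  congr 1
  push_cast
  field_simp

/-- Re-indexing the finite half-integer sums of (8): `Σ_{k=1}^{m} (k−½)^{−s} = Σ_{u<m} (m−u−½)^{−s}`. [folklore] -/
private theorem sum_Icc_half_eq_sum_range (m s : ℕ) :
    ∑ k ∈ Icc 1 m, (((k : ℝ) - 1 / 2) ^ s)⁻¹ = ∑ u ∈ range m, ((-(u : ℝ) - 1 / 2 + m) ^ s)⁻¹ := by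
  refine sum_nbij' (fun k => m - k) (fun u => m - u) ?_ ?_ ?_ ?_ ?_
  · intro k hk; have := mem_Icc.1 hk; exact mem_range.2 (by omega)
  · intro u hu; have := mem_range.1 hu; exact mem_Icc.2 ⟨by omega, by omega⟩
  · intro k hk; have := mem_Icc.1 hk; omega
  · intro u hu; have := mem_range.1 hu; omega
  · intro k hk
    have := mem_Icc.1 hk
    rw [Nat.cast_sub (by omega)]
    congr 1
    ring

/-- **The bracket of the "more suitable" expression**: for `n ≥ 1`, `m ≤ n`, `ω = ⌊(n−1)/2⌋` and every `s`,
`d_n^{s} · (Σ_{u ≤ ω} (m−u−½)^{−s} − Σ_{k=1}^{m} (k−½)^{−s}) ∈ ℤ` — after cancellation only half-integers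
`m−u−½` with `|2m−2u−1| ≤ n` remain (the two correction sums of (12)).
[cite: RivoalZudilin2020, §3 (proof of Proposition 1 (ii), display (12) and the expression for q̂_{0,n})] -/
theorem isZ_bracket {n : ℕ} (hn : 1 ≤ n) {m : ℕ} (hm : m ≤ n) (s : ℕ) :
    IsZ ((Nat.lcmUpto n : ℝ) ^ s *
      (∑ u ∈ range ((n - 1) / 2 + 1), ((-(u : ℝ) - 1 / 2 + m) ^ s)⁻¹
        - ∑ k ∈ Icc 1 m, (((k : ℝ) - 1 / 2) ^ s)⁻¹)) := by
  set ω := (n - 1) / 2 with hω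
  rw [sum_Icc_half_eq_sum_range]
  set f : ℕ → ℝ := fun u => ((-(u : ℝ) - 1 / 2 + m) ^ s)⁻¹ with hf
  by_cases hcase : m ≤ ω + 1
  · rw [← sum_Ico_eq_sub f hcase, mul_sum]
    refine IsZ.sum _ fun u hu => ?_
    have hu' := mem_Ico.1 hu
    exact isZ_lcm_pow_mul_inv_half_pow (by omega) s
  · have hle : ω + 1 ≤ m := by omega
    rw [show (∑ u ∈ range (ω + 1), f u) - ∑ u ∈ range m, f u = -∑ u ∈ Ico (ω + 1) m, f u by
      rw [sum_Ico_eq_sub f hle]; ring, mul_neg, mul_sum]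
    refine IsZ.neg (IsZ.sum _ fun u hu => ?_)
    have hu' := mem_Ico.1 hu
    exact isZ_lcm_pow_mul_inv_half_pow (by omega) s

/-- **`Φ_n^{−3} d_n^{A+2} q̂_{0,n} ∈ ℤ`** ("an analysis similar to [zud2] shows that …"), via the vanishing sum
`Σ_{u=0}^{ω} R″(−u−½) = 0` added to (8). [cite: RivoalZudilin2020, Proposition 1 (ii) (q̂_{0,n})] -/
theorem isZ_qZeroHat (A n : ℕ) (hA : 15 ≤ A) :
    IsZ ((Nat.lcmUpto n : ℝ) ^ (A + 2) / (Phi n : ℝ) ^ 3 * qZeroHat A n) := by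
  rcases Nat.eq_zero_or_pos n with rfl | hn
  · have : qZeroHat A 0 = 0 := by simp [qZeroHat]
    rw [this, mul_zero]
    exact ⟨0, by simp⟩
  set ω := (n - 1) / 2 with hω
  set D := (Nat.lcmUpto n : ℝ) ^ (A + 2) / (Phi n : ℝ) ^ 3 with hD
  set Su : ℕ → ℕ → ℝ := fun j m => ∑ u ∈ range (ω + 1), ((-(u : ℝ) - 1 / 2 + m) ^ (j + 2))⁻¹ with hSu
  set Sk : ℕ → ℕ → ℝ := fun j m => ∑ k ∈ Icc 1 m, (((k : ℝ) - 1 / 2) ^ (j + 2))⁻¹ with hSk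
  -- the vanishing sum, expanded
  have hzero : ∑ u ∈ range (ω + 1), iteratedDeriv 2 (rfun A n) (-(u : ℝ) - 1 / 2) = 0 :=
    sum_eq_zero fun u hu => iteratedDeriv_two_rfun_half_eq_zero A n (by have := mem_range.1 hu; omega)
  have hexp : ∑ u ∈ range (ω + 1), iteratedDeriv 2 (rfun A n) (-(u : ℝ) - 1 / 2)
      = ∑ m ∈ range (n + 1), ∑ j ∈ Icc 1 A, pCoeff A n j m * ((j : ℝ) * (j + 1)) * Su j m := by
    rw [sum_congr rfl fun u _ => iteratedDeriv_two_rfun_of_ne A n hA (fun i _ => half_add_nat_ne_zero u i),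
      sum_comm]
    refine sum_congr rfl fun m _ => ?_
    rw [sum_comm]
    refine sum_congr rfl fun j _ => ?_
    rw [hSu, mul_sum]
  -- (8) in the same shape
  have hq : qZeroHat A n = -∑ m ∈ range (n + 1), ∑ j ∈ Icc 1 A, pCoeff A n j m * ((j : ℝ) * (j + 1)) * Sk j m := by
    rw [qZeroHat, sum_comm]
    congr 1
    refine sum_congr rfl fun m _ => sum_congr rfl fun j _ => ?_
    rw [hSk, mul_sum]
    refine sum_congr rfl fun k _ => ?_
    rw [div_eq_mul_inv]
    ring
  -- combine
  have key : D * qZeroHat A n = ∑ m ∈ range (n + 1), ∑ j ∈ Icc 1 A,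
      ((j : ℝ) * (j + 1)) * ((Nat.lcmUpto n : ℝ) ^ (A - j) / (Phi n : ℝ) ^ 3 * pCoeff A n j m) *
        ((Nat.lcmUpto n : ℝ) ^ (j + 2) * (Su j m - Sk j m)) := by
    have h1 : D * qZeroHat A n = D * qZeroHat A n
        + D * ∑ u ∈ range (ω + 1), iteratedDeriv 2 (rfun A n) (-(u : ℝ) - 1 / 2) := by
      rw [hzero, mul_zero, add_zero]
    rw [h1, hexp, hq, mul_neg, neg_add_eq_sub, mul_sum, mul_sum, ← sum_sub_distrib]
    refine sum_congr rfl fun m _ => ?_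
    rw [mul_sum, mul_sum, ← sum_sub_distrib]
    refine sum_congr rfl fun j hj => ?_
    have hj' := mem_Icc.1 hj
    have hsplit : (Nat.lcmUpto n : ℝ) ^ (A + 2) = (Nat.lcmUpto n : ℝ) ^ (A - j) * (Nat.lcmUpto n : ℝ) ^ (j + 2) := by
      rw [← pow_add]; congr 1; omega
    rw [hD, hsplit]
    ring
  rw [key]
  refine IsZ.sum _ fun m hm => IsZ.sum _ fun j hj => ?_
  have hm' : m ≤ n := by have := mem_range.1 hm; omega
  have hj' := mem_Icc.1 hj
  have hjj : IsZ ((j : ℝ) * (j + 1)) := ⟨(j : ℤ) * ((j : ℤ) + 1), by push_cast; ring⟩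
  have hp := isZ_pCoeff A n hA hm' hj'.1 hj'.2
  have hbr := isZ_bracket hn hm' (j + 2)
  exact (hjj.mul hp).mul hbr

/-! ### Proposition 1 (ii) -/

/-- **Rivoal–Zudilin 2020, Proposition 1 (ii)** — the named fact `proposition1_ii` is a THEOREM:
for `A ≥ 16` and `n ≥ 0` both even, `Φ_n^{−3} d_n^{A+2}` is a common denominator of `q_{0,n}`, `q̂_{0,n}` and the
`q_{j,n}`, `j` odd, `5 ≤ j ≤ A+1`. (The proof uses neither parity; they are hypotheses of the printed
statement.) [cite: RivoalZudilin2020, Proposition 1 (ii)] -/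
theorem proposition1_ii_holds : proposition1_ii := by
  intro A n hA _ _
  have hA' : 15 ≤ A := by omega
  refine ⟨isZ_qZero A n hA', isZ_qZeroHat A n hA', fun j hj => ?_⟩
  have hj' := mem_filter.1 hj
  have hj'' := mem_Icc.1 hj'.1
  exact isZ_qCoeff A n hA' (by omega) (by omega)

end Literature.NumberTheory.Irrationality.RivoalZudilin2020
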